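import Literature.MathematicalPhysics.QuantumFieldTheory.Balaban1983to89.B9Thm312WholeLeaf
import Literature.MathematicalPhysics.QuantumFieldTheory.Balaban1983to89.B9Ineq347Reading

/-!
# `Balaban1983to89.B9Thm312WholeLeft` — [B9] Theorem 3.12 (p. 423), III: the LEFT sup entry (3.42)₂ (∇_UG, ∇_UG₁) and the
# global entries (3.47)ₙ, n ≠ 3, AT ONE MEMBER — from the derivative of the perturbation step and the glob readings

T. Bałaban, *Propagators for lattice gauge theories in a background field*, Commun. Math. Phys. **99** (1985) 389–434
[`Balaban1985BackgroundPropagators`, "B9"]; [4] = T. Bałaban, *Propagators and renormalization transformations for lattice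
gauge theories. II*, Commun. Math. Phys. **96** (1984) 223–250 [`Balaban1984PropagatorsII`].

statement-level skeleton of published theorems with citation tags; proofs where landed; nothing here is a claim about the
Yang–Mills mass gap

THE PRINTED LOCI (verbatim, held text `paper:balaban1985-cmp99-background-propagators`).  (3.42) p. 397: *"|(G′(U)λ)(x)|,
|(∇_UG′(U)λ)(x)|, |(G′(U)∇*_Uλ)(x)|, |(Δ_UG′(U)λ)(x)| ≦ B₀[(L^jη)², L^jη, L^jη, 1]e^{−δ₀d(y,y′)}|λ| for x ∈ Δ(y), y ∈ Λ_j, supp λ ⊂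
Δ(y′)"*; (3.47) p. 398: *"|G′(U)λ|_{(2+γ)}, |∇_UG′(U)λ|_{(1+γ)}, |G′(U)∇*_Uλ|_{(1+γ)}, |∇_UG′(U)λ|_{(γ)} ≦ B₀|λ|_{(γ)} (3.47) for γ in a
fixed compact subset of real numbers, e.g. for γ ∈ [−4, 4]"*, *"It is easy to see that the global inequalities (3.47) are
consequences of the local ones (3.42) and Lemma 2.1."*; p. 421: *"It is easy to find estimates for the operator Δ′_π, using
Theorem 3.1 and the inequality (3.49), we have to be careful only with the third term in the definition (3.120) of Δ′_π. One of
the three derivatives there has to be applied either to an expression on the right, or on the left, of Δ′_π"*; (3.130) p. 421: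
*"G = G₀(I − Δ′_πG₀)⁻¹ = Σ_{n=0}^∞ G₀(Δ′_πG₀)ⁿ"*; p. 422: *"This inequality [(3.131)] and Theorem 3.3 for G₀ imply a convergence
of the series (3.130), for α₀ sufficiently small, in all norms appearing on the left-hand sides of the inequalities
(3.42)–(3.47), except the inequality involving the Laplace operator in (3.42). Thus we have Theorem 3.3. for G, with this
exception."*; Theorem 3.12 p. 423 (verbatim in `…B9Thm312Whole`).  [4] Lemma 2.1 p. 234: (2.60) *"e^{−αδ₀d(y,y′)} ≦
e^{−αδ₀RM max{|j−j′|−1,0}}"*, (2.61) *"sup_{y∈𝔅} Σ_{y′∈𝔅} e^{−αδ₀d(y,y′)} ≦ c₁(α)"*.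

THE POINT.  Seat n06-l's leaves `…B9Thm312WholeLeaf.thm312Printed_of_step` (row 20) and `…B9Thm313Whole.thm313Printed_of_step`
(row 21) PROVE the sup entries (3.42)₁, (3.42)₃ of G, G₁, 𝔊 from printed-shape schemas and DISPLAY, among the residual members
`hres`, the LEFT sup entry (3.42)₂ (`Clause342 K 1 B₁ δ₁ U`) and the whole global block (3.47)ₙ, n ≠ 3.  THIS FILE supplies,
at ONE member and ONE configuration U, the two printed steps that remove them:
* §1 `LeftStep 𝔬 R₀ H₀ hlen B₀ δ₀ θ δK U` — A HYPOTHESIS SCHEMA OF PRINTED SHAPE (nothing asserted): `e1` = Theorem 3.3's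
  entry (3.42)₂ for G₀ (|(∇_UG₀λ)(x)| ≦ B₀L^jη·e^{−δ₀d}|λ|, the companion of `Thm33G0.e0`∕`.e2`); `stepD`, `stepD1` = THE
  DERIVATIVE OF THE PERTURBATION STEP, ∇_UG₀Δ′_π and ∇_UG₀(Δ′_π + Δ⁽²⁾_π), with the block majorant θe^{−δ_K d} from the state
  norm 𝔠⁽²⁾ of the bond fields into the state norm 𝔠_Y⁽¹⁾ of their covariant derivatives (θ = O(1)·Mα₀ in print) — the
  (3.42)₂-norm instance of p. 422's *"convergence … in all norms … except the Laplacian"*, of the same species as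
  `…B9Thm312Whole.Step` (the 𝔠⁽ᵖ⁾ → 𝔠⁽ᵖ⁾ instance); in the cell's md `SectD-sup-proof.md` THEOREM S it is Step 4's factor
  (∇_U𝒢)∘𝒯 (its derivation from (3.42)–(3.45), (3.49) is the md's Lemma 4.3, not typed — declared).
* §2 ★ `entry1_of_stepD` — THEOREM 3.12, ENTRY (3.42)₂ FOR G (OR G₁), PRINTED SHAPE: ∇_UA = ∇_UG₀ + (∇_UG₀T)A (`comp_fix_left`,
  from A = G₀ + G₀TA), the right entry A : 𝔠⁽⁰⁾ → 𝔠⁽²⁾ of `…Leaf.hasMaj_right_of_step`, one composition ([4] (2.54) + (2.61),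
  `B11SectG.hasMaj_comp_exp`) ⇒ |(∇_UAλ)(x)| ≦ (B₀ + θ·B₀(1 − θc)⁻¹·c)·L^jη·e^{−ρd(y,y′)}|λ| (ρ ≦ δ₀, ρ + σ ≦ δ_K, θc < 1).
* §3 THE GLOBAL ENTRIES PER ENTRY: `Lemma21AboveG` ([4] Lemma 2.1 above an M-threshold at the rate δ and exponent α with a
  GENERIC row-sum constant: (2.60), `B11SectG.RowSum … ((1−α)δ) c`, and the size condition 4·log L ≦ αδRM of the scale
  transfer — the door seat n06-j asked for, since the printed c₁ is refuted as typed, `B6Lemma21Counterexample`),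
  `lemma21AboveG_of_above` (n06-h's printed-constant `B9Ineq347Reading.Lemma21Above` implies it), ★ `globEntry_of_clause342` — the
  printed *"easy to see"* step FOR ONE ENTRY n (so that Theorem 3.12's «n ≠ 3» can be served): `Clause342 K n B δ U` + the
  reading axioms `B9Ineq347Reading.GlobReading K P U res` + (2.60) at (δ, α) + the row sum at (1−α)δ + 4·log L ≦ αδRM + L ≧ 1, η > 0,
  |·|_{(γ)} ≧ 0 ⇒ `K.glob n U lam γ ≦ (B·c·L⁴)·|lam|_{(γ)}` ON `P`, γ ∈ [−4, 4] (route and proof = n06-h's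
  `globBlockOn_of_eBlockOn`, entry by entry, generic constant); `globEntry_all_of_on` — the same for ALL arguments given
  the null reading OFF `P` (the pattern of `B9ResidualEntriesAtOne`).
The family theorems consuming §1–§3 (the leaves of rows 20–21 with (3.42)₂ and (3.47)₀,₁,₂ PROVED INSIDE) are the sequel
`…B9Thm312WholeLeafLeftGlob`.

HONEST SCOPE.  Nothing of [B9] or [4] is asserted: Theorem 3.3 for G₀, the derivative step, Lemma 2.1 and the four reading
axioms are HYPOTHESES of printed ∕ definitional shape; the content is the printed bookkeeping (one resolvent identity, one
composition, one block-by-block summation), kernel-checked at the level the N06 knit consumes.  NOT a node discharge, NOT summit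
progress; one finite lattice at a time; nothing continuum, nothing about the mass gap.  Cell `pub-ymgap` (HUMAN RULING D-0062),
Track A node N06 [B9], N06-ASSIGNMENT v1 rows 20–21 (bundle F7), seat `pub-ymgap-dag-n06-l` (g2), 2026-08-26.
-/

namespace Literature.MathematicalPhysics.QuantumFieldTheory.Balaban1983to89.B9Thm312WholeLeft

open Literature.MathematicalPhysics.QuantumFieldTheory.Balaban1983to89
open Finset B6RandomWalk B6RandomWalkHom B9Thm34Ext B9Thm37GlueCor36 B11SectG B9SectDSup
open B9Thm37AllNorms B9Thm37AllNormsInstances B9FromB6 B9FromB6ModelSignsOn B9Thm312Whole B9Thm312WholeLeaf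

noncomputable section

/-! ## §1 The derivative of the perturbation step (printed shape; nothing asserted) -/

section OneMember

variable {g : B9.Geometry} {B : B9.Backgrounds} {X Y Z W : Type}
variable [Fintype X] [Fintype Y] [Fintype g.Site]

/-- **THE LEFT-ENTRY DATA OF THEOREM 3.12 AT THE CONFIGURATION U** (a hypothesis schema of printed shape; nothing asserted):
`e1` = THEOREM 3.3, ENTRY (3.42)₂ FOR G₀ — |(∇_UG₀λ)(x)| ≦ B₀L^jη·e^{−δ₀d(y,y′)}|λ| for x ∈ Δ(y), supp λ ⊂ Δ(y′) (p. 399: G₀ =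
G(U) *"satisfies the inequalities (3.42)–(3.47)"*; the companion of `Thm33G0.e0`, `.e2`); `stepD` ∕ `stepD1` = THE DERIVATIVE OF
THE PERTURBATION STEPS OF (3.130) ∕ (3.138): ∇_UG₀Δ′_π and ∇_UG₀(Δ′_π + Δ⁽²⁾_π) have the block majorant θe^{−δ_K d(y,y′)} from the
state norm 𝔠⁽²⁾ (bond fields, weight (L^jη)⁻²) into 𝔠_Y⁽¹⁾ (their covariant derivatives, weight (L^jη)⁻¹), i.e.
sup_{Δ(y)}|∇_UG₀Δ′_πf| ≦ θ(L^jη)(L^{j′}η)⁻²e^{−δ_K d(y,y′)}sup_{Δ(y′)}|f| for supp f ⊂ Δ(y′) — the (3.42)₂-norm member of p. 422's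
*"convergence of the series (3.130), for α₀ sufficiently small, in all norms appearing on the left-hand sides of the
inequalities (3.42)–(3.47), except the inequality involving the Laplace operator"* (θ = O(1)·Mα₀: *"each operator Δ′_π
provides the small factor α₀"*), the same species as `…B9Thm312Whole.Step`; in the cell md THEOREM S (Step 4) it is the factor
(∇_U𝒢)∘𝒯, whose derivation from (3.42)–(3.45), (3.49) is the md's Lemma 4.3 (not typed).
[cite: Balaban1985BackgroundPropagators, Thm 3.3 p.399 + (3.42) p.397 + (3.130)–(3.131) pp.421–422 + (3.137)–(3.138) p.423] -/
structure LeftStep (𝔬 : Ops g B X Y Z W) (R₀ : ℝ) (H₀ : Prop) (hlen : ∀ y : g.Site, 0 ≤ g.len y) (B₀ δ₀ θ δK : ℝ)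
    (U : B.Cfg) : Prop where
  e1 : HasMajorantHom (g := toB6 g R₀ H₀) 𝔬.blk 𝔬.blkY (𝔬.D U ∘ₗ 𝔬.G0 U)
    (fun (a b : g.Site) => B₀ * g.len a * Real.exp (-(δ₀ * g.dist a b)))
  stepD : HasMaj (cNorm R₀ H₀ 𝔬.blk hlen 2) (cNorm R₀ H₀ 𝔬.blkY hlen 1) (𝔬.D U ∘ₗ 𝔬.G0 U ∘ₗ 𝔬.Tpi U)
    (fun a b => θ * Real.exp (-(δK * (toB6 g R₀ H₀).dist a b)))
  stepD1 : HasMaj (cNorm R₀ H₀ 𝔬.blk hlen 2) (cNorm R₀ H₀ 𝔬.blkY hlen 1) (𝔬.D U ∘ₗ 𝔬.G0 U ∘ₗ (𝔬.Tpi U + 𝔬.T2 U))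
    (fun a b => θ * Real.exp (-(δK * (toB6 g R₀ H₀).dist a b)))

/-! ## §2 One member, one U: the left sup entry (3.42)₂ of G and G₁ -/

omit [Fintype X] [Fintype Y] [Fintype g.Site] in
/-- **(3.130) differentiated on the left**: A = G₀ + G₀TA gives ∇A = ∇G₀ + (∇G₀T)A — every leading derivative lands on a G₀
(p. 421: *"One of the three derivatives there has to be applied either to an expression on the right, or on the left, of Δ′_π"*).
[cite: Balaban1985BackgroundPropagators, (3.130) p.421] -/
theorem comp_fix_left {G0 T A : Module.End ℝ (X → ℝ)} (Dop : (X → ℝ) →ₗ[ℝ] (Y → ℝ)) (hfix : A = G0 + G0 ∘ₗ T ∘ₗ A) :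
    Dop ∘ₗ A = Dop ∘ₗ G0 + (Dop ∘ₗ G0 ∘ₗ T) ∘ₗ A := by
  refine LinearMap.ext fun f => ?_
  have hpt : A f = G0 f + G0 (T (A f)) := by
    conv_lhs => rw [hfix]
    simp only [LinearMap.add_apply, LinearMap.comp_apply]
  simp only [LinearMap.comp_apply, LinearMap.add_apply]
  conv_lhs => rw [hpt]
  rw [map_add]

omit [Fintype Y] in
/-- The right entry G (or G₁) itself, 𝔠⁽⁰⁾ → 𝔠⁽²⁾, with decay (the `HasMaj` form behind `…Leaf.entry0_of_step`): from (3.42)₁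
for G₀, the step on 𝔠⁽²⁾ and the resolvent identity, A : 𝔠⁽⁰⁾ → 𝔠⁽²⁾ has majorant B₀(1 − θc)⁻¹e^{−ρd}.
[cite: Balaban1985BackgroundPropagators, Thm 3.12 p.423 + (3.42) p.397 + (3.130) p.421] -/
theorem hasMaj_entry0_cNorm {R₀ : ℝ} {H₀ : Prop} (hG : GeoOK g) {blk : X → g.Site} {G0 T A : Module.End ℝ (X → ℝ)}
    {θ B₀ δ₀ δK ρ σ c : ℝ} (hrow : RowSum (toB6 g R₀ H₀) σ c)
    (hθ : 0 ≤ θ) (hB₀ : 0 ≤ B₀) (hρ : 0 ≤ ρ) (hρS : ρ ≤ δ₀) (hρδ : ρ + σ ≤ δK)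
    (hK : HasMaj (cNorm R₀ H₀ blk hG.lenle 2) (cNorm R₀ H₀ blk hG.lenle 2) (G0 ∘ₗ T)
      (fun a b => θ * Real.exp (-(δK * g.dist a b))))
    (he0 : HasMajorant (g := toB6 g R₀ H₀) blk G0 (fun a b => B₀ * g.len a ^ 2 * Real.exp (-(δ₀ * g.dist a b))))
    (hfix : A = G0 + G0 ∘ₗ T ∘ₗ A) (hq : θ * c < 1) :
    HasMaj (cNorm R₀ H₀ blk hG.lenle 0) (cNorm R₀ H₀ blk hG.lenle 2) A
      (fun a b => B₀ * (1 - θ * c)⁻¹ * Real.exp (-(ρ * g.dist a b))) := by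
  have h0 : HasMaj (BlockNorm.ofBlocks (toB6 g R₀ H₀) blk) (BlockNorm.ofBlocks (toB6 g R₀ H₀) blk) G0
      (fun a b => B₀ * g.len a ^ 2 * Real.exp (-(δ₀ * g.dist a b))) :=
    hasMaj_of_hasMajorant (g := toB6 g R₀ H₀) blk
      (fun a b => mul_nonneg (mul_nonneg hB₀ (sq_nonneg _)) (Real.exp_nonneg _)) he0
  have hS : HasMaj (cNorm R₀ H₀ blk hG.lenle 0) (cNorm R₀ H₀ blk hG.lenle 2) (G0 ∘ₗ LinearMap.id)
      (fun a b => B₀ * Real.exp (-(δ₀ * g.dist a b))) := by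
    rw [LinearMap.comp_id]
    refine (hasMaj_cNorm_of_hasMaj hG 2 0 h0).mono fun y y' => le_of_eq ?_
    have hy : g.len y ^ 2 ≠ 0 := pow_ne_zero 2 (hG.lenpos y).ne'
    simp only [wt, pow_zero, mul_one]
    rw [mul_assoc B₀, mul_comm (g.len y ^ 2), ← mul_assoc B₀, mul_assoc, mul_assoc, mul_inv_cancel₀ hy, mul_one]
  have h := hasMaj_right_of_step hG hrow hθ hB₀ hρ hρS hρδ hK hS hfix hq
  rw [LinearMap.comp_id] at h
  exact h

/-- ★ **THEOREM 3.12, ENTRY (3.42)₂ FOR G (OR G₁), PRINTED SHAPE** — the left sup entry: from Theorem 3.3's entries (3.42)₁ (`he0`)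
and (3.42)₂ (`he1`) for G₀, the step K′ = G₀T on 𝔠⁽²⁾ (θe^{−δ_K d}, θc < 1), its derivative ∇_UK′ : 𝔠⁽²⁾ → 𝔠_Y⁽¹⁾ (θ′e^{−δ_K d}), the
resolvent identity A = G₀ + G₀TA and the row sum (2.61) at the rate σ (ρ ≦ δ₀, ρ + σ ≦ δ_K): |(∇_UAλ)(x)| ≦ (B₀ + θ′·B₀(1 −
θc)⁻¹·c)·L^jη·e^{−ρd(y,y′)}|λ| for x ∈ Δ(y), supp λ ⊂ Δ(y′) (T = Δ′_π gives G, T = Δ′_π + Δ⁽²⁾_π gives G₁).  Route: ∇_UA = ∇_UG₀ +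
(∇_UG₀T)A (`comp_fix_left`); the second term is ONE composition ([4] (2.54) + (2.61)) of ∇_UG₀T with the right entry A : 𝔠⁽⁰⁾ →
𝔠⁽²⁾ of `hasMaj_entry0_cNorm`. [cite: Balaban1985BackgroundPropagators, Thm 3.12 p.423 + (3.42) p.397 + (3.130) p.421 + p.422; Balaban1984PropagatorsII, Lemma 2.1 p.234] -/
theorem entry1_of_stepD {R₀ : ℝ} {H₀ : Prop} (hG : GeoOK g) {blk : X → g.Site} {blkY : Y → g.Site}
    {G0 T A : Module.End ℝ (X → ℝ)} {Dop : (X → ℝ) →ₗ[ℝ] (Y → ℝ)}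
    {θ θ' B₀ δ₀ δK ρ σ c : ℝ} (hrow : RowSum (toB6 g R₀ H₀) σ c)
    (hθ : 0 ≤ θ) (hθ' : 0 ≤ θ') (hB₀ : 0 ≤ B₀) (hρ : 0 ≤ ρ) (hρS : ρ ≤ δ₀) (hρδ : ρ + σ ≤ δK)
    (hK : HasMaj (cNorm R₀ H₀ blk hG.lenle 2) (cNorm R₀ H₀ blk hG.lenle 2) (G0 ∘ₗ T)
      (fun a b => θ * Real.exp (-(δK * g.dist a b))))
    (hKD : HasMaj (cNorm R₀ H₀ blk hG.lenle 2) (cNorm R₀ H₀ blkY hG.lenle 1) (Dop ∘ₗ G0 ∘ₗ T)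
      (fun a b => θ' * Real.exp (-(δK * g.dist a b))))
    (he0 : HasMajorant (g := toB6 g R₀ H₀) blk G0 (fun a b => B₀ * g.len a ^ 2 * Real.exp (-(δ₀ * g.dist a b))))
    (he1 : HasMajorantHom (g := toB6 g R₀ H₀) blk blkY (Dop ∘ₗ G0)
      (fun a b => B₀ * g.len a * Real.exp (-(δ₀ * g.dist a b))))
    (hfix : A = G0 + G0 ∘ₗ T ∘ₗ A) (hq : θ * c < 1) :
    HasMajorantHom (g := toB6 g R₀ H₀) blk blkY (Dop ∘ₗ A)
      (fun a b => (B₀ + θ' * (B₀ * (1 - θ * c)⁻¹) * c) * g.len a * Real.exp (-(ρ * g.dist a b))) := by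
  have hq1 : 0 ≤ (1 - θ * c)⁻¹ := inv_nonneg.mpr (by linarith)
  have hA₁ : 0 ≤ B₀ * (1 - θ * c)⁻¹ := mul_nonneg hB₀ hq1
  have htri : Triangle254 (toB6 g R₀ H₀) := fun a b c => hG.tri a b c
  -- the right entry A : 𝔠⁽⁰⁾ → 𝔠⁽²⁾
  have hGF := hasMaj_entry0_cNorm hG hrow hθ hB₀ hρ hρS hρδ hK he0 hfix hq
  -- ∇_UG₀ : 𝔠⁽⁰⁾ → 𝔠_Y⁽¹⁾ from (3.42)₂ for G₀
  have h10 : HasMaj (BlockNorm.ofBlocks (toB6 g R₀ H₀) blk) (BlockNorm.ofBlocks (toB6 g R₀ H₀) blkY) (Dop ∘ₗ G0)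
      (fun a b => B₀ * g.len a * Real.exp (-(δ₀ * g.dist a b))) :=
    hasMaj_of_hasMajorantHom (G := toB6 g R₀ H₀) blk blkY
      (fun a b => mul_nonneg (mul_nonneg hB₀ (hG.lenle a)) (Real.exp_nonneg _)) he1
  have h1 : HasMaj (cNorm R₀ H₀ blk hG.lenle 0) (cNorm R₀ H₀ blkY hG.lenle 1) (Dop ∘ₗ G0)
      (fun a b => B₀ * Real.exp (-(δ₀ * g.dist a b))) := by
    refine (hasMaj_cNorm_of_hasMaj hG 1 0 h10).mono fun y y' => le_of_eq ?_
    have hy : g.len y ≠ 0 := (hG.lenpos y).ne'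
    simp only [wt, pow_zero, pow_one, mul_one]
    rw [mul_assoc B₀, mul_comm (g.len y), ← mul_assoc B₀, mul_assoc, mul_inv_cancel₀ hy, mul_one]
  -- a row-sum constant is non-negative as soon as there is a site (else everything is vacuous)
  have hc : 0 ≤ c ∨ IsEmpty g.Site := by
    by_cases hne : Nonempty g.Site
    · exact Or.inl (hrow.nonneg hne.some)
    · exact Or.inr (not_nonempty_iff.mp hne)
  rcases hc with hc | hemp
  swap
  · intro y' μ B' hμ v
    exact (IsEmpty.false (blkY v)).elim
  -- (∇_UG₀T)A : 𝔠⁽⁰⁾ → 𝔠_Y⁽¹⁾, one composition at the rate ρ (ρ + σ ≦ δ_K)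
  have h2 : HasMaj (cNorm R₀ H₀ blk hG.lenle 0) (cNorm R₀ H₀ blkY hG.lenle 1) ((Dop ∘ₗ G0 ∘ₗ T) ∘ₗ A)
      (fun a b => (cNorm R₀ H₀ blk hG.lenle 2 (X := X)).κ * θ' * (B₀ * (1 - θ * c)⁻¹) * c *
        Real.exp (-(ρ * g.dist a b))) :=
    hasMaj_comp_exp htri hG.dnn hrow hθ' hA₁ hρ le_rfl hρδ hKD hGF
  simp only [cNorm_κ, one_mul] at h2
  have hsum := (h1.of_rate_le hG.dnn hB₀ hρS).add h2
  rw [← comp_fix_left Dop hfix] at hsum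
  have hC0 : 0 ≤ B₀ + θ' * (B₀ * (1 - θ * c)⁻¹) * c := add_nonneg hB₀ (mul_nonneg (mul_nonneg hθ' hA₁) hc)
  have h3 : HasMaj (cNorm R₀ H₀ blk hG.lenle 0) (cNorm R₀ H₀ blkY hG.lenle 1) (Dop ∘ₗ A)
      (fun a b => (B₀ + θ' * (B₀ * (1 - θ * c)⁻¹) * c) * Real.exp (-(ρ * g.dist a b))) :=
    hsum.mono fun a b => le_of_eq (by simp only [toB6_dist]; ring)
  have h' := hasMajorantHom_of_hasMaj_cNorm hG (fun a b => mul_nonneg hC0 (Real.exp_nonneg _)) h3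
  refine hasMajorantHom_mono (g := toB6 g R₀ H₀) blk blkY h' fun a b => le_of_eq ?_
  simp only [wt, pow_zero, pow_one, inv_one, mul_one]
  ring

end OneMember

/-! ## §3 The global entries (3.47), entry by entry, from (3.42), [4] Lemma 2.1 and the glob readings -/

section Glob

variable {g : B9.Geometry} [Fintype g.Site] {B : B9.Backgrounds} {R : ℝ} {H : Prop}

/-- **[4] LEMMA 2.1 ABOVE AN M-THRESHOLD, GENERIC ROW-SUM CONSTANT** — for a family `geo` at the rate δ and the exponent α: above
`ML` every member's transported geometry satisfies (2.60) at (δ, α), the row sum (2.61) at the rate (1 − α)δ with SOME constant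
`c` (`B11SectG.RowSum`, not the printed c₁(1 − α) = 12c₀^d — refuted as typed in d ≧ 3, `B6Lemma21Counterexample`; the record's
geometry supplies a generic constant, n06-i's `rowSum261_geo9Y`), and the size condition 4·log L ≦ αδRM of the scale transfer
((2.59): *"RM sufficiently large"*).  A hypothesis schema; `lemma21AboveG_of_above` derives it from the printed-constant form
`B9Ineq347Reading.Lemma21Above`. [cite: Balaban1984PropagatorsII, Lemma 2.1 (2.59)–(2.61) pp.233–234] -/
def Lemma21AboveG {I : Type} (geo : I → B9.Geometry) [∀ i, Fintype (geo i).Site] (R : I → ℝ) (H : I → Prop)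
    (δ α ML c : ℝ) : Prop :=
  ∀ i : I, ML ≤ (geo i).M → Ineq260 (toB6 (geo i) (R i) (H i)) δ α ∧ RowSum (toB6 (geo i) (R i) (H i)) ((1 - α) * δ) c ∧
    4 * Real.log (geo i).L ≤ α * δ * R i * (geo i).M

/-- The printed-constant form (n06-h's `Lemma21Above`, (2.61) with c₁(1 − α)) gives the generic form with c := c₁(1 − α)
(`B11SectG.rowSum_iff_ineq261`). [cite: Balaban1984PropagatorsII, Lemma 2.1 (2.61) p.234 (bookkeeping)] -/
theorem lemma21AboveG_of_above {I : Type} {geo : I → B9.Geometry} [∀ i, Fintype (geo i).Site] {R : I → ℝ} {H : I → Prop}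
    (d : ℕ) {δ α ML : ℝ} (h : B9Ineq347Reading.Lemma21Above d geo R H δ α ML) : Lemma21AboveG geo R H δ α ML (B6.c1 d δ (1 - α)) := by
  intro i hi
  obtain ⟨h260, h261, hsize⟩ := h i hi
  exact ⟨h260, (rowSum_iff_ineq261 d _ δ (1 - α)).mp h261, hsize⟩

omit [Fintype g.Site] in
/-- Lʲη ≥ 0 for L ≥ 1, η > 0. [folklore] -/
private theorem len_nonneg_of (hL : 1 ≤ g.L) (hη : 0 < g.eta) (y : g.Site) : 0 ≤ g.len y :=
  mul_nonneg (pow_nonneg (le_trans zero_le_one hL) _) hη.le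

/-- ★ **«THE GLOBAL INEQUALITIES (3.47) ARE CONSEQUENCES OF THE LOCAL ONES (3.42) AND LEMMA 2.1» — ONE ENTRY, AT THE READING LEVEL,
GENERIC ROW-SUM CONSTANT.**  For one kernel family `K` at `U` and ONE n: the n-th (3.42) clause with (B₀, δ) (B₀ ≧ 0, ALL arguments),
(2.60) at (δ, α) and the row sum at (1 − α)δ with constant c for the transported geometry, L ≧ 1, η > 0, the size condition 4·log L ≦
αδRM, |·|_{(γ)} ≧ 0 and the reading axioms `GlobReading K P U res` give, for every argument ON `P` and γ ∈ [−4, 4], `K.glob n U lam γ ≦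
(B₀·c·L⁴)·|lam|_{(γ)}`.  Route = print's (and n06-h's `globBlockOn_of_eBlockOn`, which needs all four entries at once and the printed
c₁): λ = Σ_{y′}Δ(y′)λ, the clause on each piece, |Δ(y′)λ| ≦ (L^{j′}η)^γ|λ|_{(γ)}, e^{−δd} = e^{−(1−α)δd}·e^{−αδd}, scale transfer of the
weight by (2.60) (one factor L^{|γ|} ≦ L⁴ per unit), the row sum, then `glob_le`.
[cite: Balaban1985BackgroundPropagators, (3.42) p.397 + (3.47) p.398; Balaban1984PropagatorsII, Lemma 2.1 (2.60)–(2.61) p.234] -/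
theorem globEntry_of_clause342 {K : B9.KernelFamily g B} {P : g.Loc → Prop} {U : B.Cfg} {res : g.Site → g.Loc → g.Loc}
    (hR : B9Ineq347Reading.GlobReading K P U res) (n : Fin 4) {δ α B₀ c : ℝ} (hB₀ : 0 ≤ B₀) (hc : 0 ≤ c) (hL : 1 ≤ g.L) (hη : 0 < g.eta)
    (hw : ∀ (γ : ℝ) (lam : g.Loc), 0 ≤ g.wNorm γ lam) (hsize : 4 * Real.log g.L ≤ α * δ * R * g.M)
    (h260 : Ineq260 (toB6 g R H) δ α) (hrow : RowSum (toB6 g R H) ((1 - α) * δ) c) (hE : Clause342 K n B₀ δ U) :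
    ∀ (lam : g.Loc) (γ : ℝ), P lam → -4 ≤ γ → γ ≤ 4 →
      K.glob n U lam γ ≤ (B₀ * c * g.L ^ (4 : ℝ)) * g.wNorm γ lam := by
  intro lam γ hP h1 h2
  have hγ : |γ| ≤ 4 := abs_le.2 ⟨by linarith, h2⟩
  have hL0 : 0 < g.L := lt_of_lt_of_le one_pos hL
  obtain ⟨hsz, hL4⟩ := B9Ineq347AllEntries.size_condition_compact g.L γ _ hL hγ hsize
  have hST : B9Ineq347.ScaleTransfer g δ α (g.L ^ |γ|) (fun y => (g.len y) ^ γ) :=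
    B9Ineq347.scaleTransfer_of_260 g δ α (Real.exp (-(α * δ * R * g.M))) (g.L ^ |γ|) (fun y => (g.len y) ^ γ)
      (fun y y' => Nat.dist (g.scale y) (g.scale y')) (Real.exp_nonneg _) (Real.one_le_rpow hL (abs_nonneg γ))
      (B9Ineq347AllEntries.rpow_abs_mul_exp_le_one g.L γ _ hL0 hsz) (B9Ineq347AllEntries.weight_nonneg g hL0 hη γ)
      (B9Ineq347AllEntries.h260_nat_of_Ineq260 g R H δ α h260) (fun y y' => B9Ineq347AllEntries.weight_ratio g hL hη γ y y')
  set N := g.wNorm γ lam with hNdef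
  have hN : 0 ≤ N := hw γ lam
  have hΛ : 0 ≤ g.L ^ |γ| := Real.rpow_nonneg hL0.le _
  have hC : 0 ≤ B₀ * c * g.L ^ (4 : ℝ) * N :=
    mul_nonneg (mul_nonneg (mul_nonneg hB₀ hc) (Real.rpow_nonneg hL0.le _)) hN
  refine hR.glob_le n lam γ _ hP hC fun y => ?_
  have hpref : 0 ≤ B9.pref4 (g.len y) n := B9FromB6.pref4_nonneg (len_nonneg_of hL hη y) n
  have hwy : 0 ≤ (g.len y) ^ γ := B9Ineq347AllEntries.weight_nonneg g hL0 hη γ y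
  have hK : 0 ≤ B₀ * B9.pref4 (g.len y) n * N := mul_nonneg (mul_nonneg hB₀ hpref) hN
  -- the exponential split e^{−δd} = e^{−(1−α)δd}·e^{−αδd}
  have hsplit : ∀ y' : g.Site, Real.exp (-(δ * g.dist y y')) =
      Real.exp (-((1 - α) * δ * g.dist y y')) * Real.exp (-(α * δ * g.dist y y')) := by
    intro y'
    rw [← Real.exp_add]
    congr 1
    ring
  calc K.e n U lam y ≤ ∑ y' : g.Site, K.e n U (res y' lam) y := hR.e_subadd n lam y hP
    _ ≤ ∑ y' : g.Site, B₀ * B9.pref4 (g.len y) n * Real.exp (-(δ * g.dist y y')) * ((g.len y') ^ γ * N) :=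
        Finset.sum_le_sum fun y' _ =>
          (hE (res y' lam) y y' (hR.res_supp y' lam hP)).trans
            (mul_le_mul_of_nonneg_left (hR.res_norm y' lam γ hP)
              (mul_nonneg (mul_nonneg hB₀ hpref) (Real.exp_nonneg _)))
    _ = B₀ * B9.pref4 (g.len y) n * N * ∑ y' : g.Site, Real.exp (-((1 - α) * δ * g.dist y y')) *
          (Real.exp (-(α * δ * g.dist y y')) * (g.len y') ^ γ) := by
        rw [Finset.mul_sum]
        refine Finset.sum_congr rfl fun y' _ => ?_
        rw [hsplit y']
        ring
    _ ≤ B₀ * B9.pref4 (g.len y) n * N * ∑ y' : g.Site, Real.exp (-((1 - α) * δ * g.dist y y')) *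
          (g.L ^ |γ| * (g.len y) ^ γ) := by
        refine mul_le_mul_of_nonneg_left (Finset.sum_le_sum fun y' _ => ?_) hK
        exact mul_le_mul_of_nonneg_left (hST y y') (Real.exp_nonneg _)
    _ = B₀ * B9.pref4 (g.len y) n * N * (g.L ^ |γ| * (g.len y) ^ γ) *
          ∑ y' : g.Site, Real.exp (-((1 - α) * δ * g.dist y y')) := by
        rw [← Finset.sum_mul]
        ring
    _ ≤ B₀ * B9.pref4 (g.len y) n * N * (g.L ^ |γ| * (g.len y) ^ γ) * c :=
        mul_le_mul_of_nonneg_left (hrow y) (mul_nonneg hK (mul_nonneg hΛ hwy))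
    _ = (B₀ * c * g.L ^ |γ| * N) * B9.pref4 (g.len y) n * (g.len y) ^ γ := by ring
    _ ≤ (B₀ * c * g.L ^ (4 : ℝ) * N) * B9.pref4 (g.len y) n * (g.len y) ^ γ := by
        have h4 : B₀ * c * g.L ^ |γ| * N ≤ B₀ * c * g.L ^ (4 : ℝ) * N :=
          mul_le_mul_of_nonneg_right (mul_le_mul_of_nonneg_left hL4 (mul_nonneg hB₀ hc)) hN
        exact mul_le_mul_of_nonneg_right (mul_le_mul_of_nonneg_right h4 hpref) hwy

omit [Fintype g.Site] in
/-- **(3.47)ₙ for ALL arguments** from the entry ON `P` and the null reading OFF `P` (the operator's summand at the carriers of record: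
`B9ResidualEntriesAtOne`'s pattern `…_of_globOn_of_null`): OFF `P` the weighted reading is ≦ 0 ≦ C·|lam|_{(γ)}.
[cite: Balaban1985BackgroundPropagators, (3.47) p.398 (bookkeeping)] -/
theorem globEntry_all_of_on {K : B9.KernelFamily g B} {P : g.Loc → Prop} {U : B.Cfg} {n : Fin 4} {C : ℝ} (hC : 0 ≤ C)
    (hw : ∀ (γ : ℝ) (lam : g.Loc), 0 ≤ g.wNorm γ lam)
    (hon : ∀ (lam : g.Loc) (γ : ℝ), P lam → -4 ≤ γ → γ ≤ 4 → K.glob n U lam γ ≤ C * g.wNorm γ lam)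
    (hnull : ∀ (lam : g.Loc) (γ : ℝ), ¬ P lam → K.glob n U lam γ ≤ 0) :
    ∀ (lam : g.Loc) (γ : ℝ), -4 ≤ γ → γ ≤ 4 → K.glob n U lam γ ≤ C * g.wNorm γ lam := by
  intro lam γ h1 h2
  by_cases hP : P lam
  · exact hon lam γ hP h1 h2
  · exact (hnull lam γ hP).trans (mul_nonneg hC (hw γ lam))

end Glob

end

end Literature.MathematicalPhysics.QuantumFieldTheory.Balaban1983to89.B9Thm312WholeLeft
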